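import Summits.HodgeConjecture.CorCM.HypDel.M1primeOfFUPart7
import Literature.AlgebraicGeometry.HodgeTheory.GriffithsHolomorphicHodgeSubbundlesQPHolds
import Literature.AlgebraicGeometry.HodgeTheory.MotivatedClassesDeformationInputs
import Literature.AlgebraicGeometry.HodgeTheory.RationalLattice
import Literature.AlgebraicGeometry.HodgeTheory.ComplexConjugationHolds
import Literature.AlgebraicGeometry.HodgeTheory.SmoothQuasiProjectiveComponents
import Literature.AlgebraicGeometry.AbelianSchemes.PolarizedAbelianSchemeWithLevelBaseChange
import HarnessLib

/-!
# Griffiths' theorem for the universal family over the Siegel fine moduli scheme: the Hodge bundles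
# `F^p𝓗^k` of `X ⊗ ℂ → M ⊗ ℂ` are holomorphic subbundles (local holomorphic frames), on every
# smooth pure-dimensional open piece of `M ⊗ ℂ` — the analytic input «U-e P3» of the complex
# uniformisation road, WITHOUT using (U)

Cell hodgecm-mathlib (D-0151), rung 0 of the Mumford line under `HDel` (item `stmt-HodgeConjecture-24835`),
U-DAG §2 node U-e P3 (B-plan1 (g10) R76, 2026-08-29). HC_CM is proved only modulo the 7 printed citations
until rung 0 closes; nothing in this file changes that count (a (U)-road leaf, books 0).

The U-DAG of the programme priced node U-e («the analytic clauses of the uniformisation `unif_c`») against the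
named fact `HodgeTheory.Griffiths1968_holomorphicHodgeSubbundles` (Voisin I Thm. 10.3, proper families; no
`_holds` in the tree). The QUASI-PROJECTIVE-TOTAL-SPACE form of that fact is a THEOREM of the tree,
`HodgeTheory.griffiths1968_holomorphicHodgeSubbundlesQP_holds` (cell hodge-nonav, harmonic route), and the
universal family of a Siegel fine moduli scheme `𝓜` HAS quasi-projective total space ((F-c″), the third
conjunct of `lan2013_siegelFineModuliScheme`, transferred to every `𝓜` by `M1primeOfFU.smooth_qproj_of_F`).
This file performs the instantiation:

* `isSmoothProjective_fiberOver_univFamilyℂ` — every complex fibre of the complexified universal family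
  `univFamilyℂ 𝓜 : X ⊗ ℂ → M ⊗ ℂ` is a smooth projective variety of dimension `g`, proved from the fine-moduli
  base change D-BC∃ (`PolarizedAbelianSchemeWithLevel.exists_isBaseChangeVia`) at the `ℚ`-side reading of the
  point — NOT from the uniformisation (the E-FU part 7 lemma `W1.isSmoothProjectiveFamily_univFamilyℂ` takes the
  (U)-clauses `hsurj`/`hU3` as hypotheses and is therefore unusable inside a proof OF (U));
* `isSmoothProjectiveFamily_univFamilyℂ_of_classify` — the complexified universal family is a smooth projective family of
  relative dimension `g` ((U)-free), and `isSmoothProjectiveFamily_familyPullback_univFamilyℂ` — so is its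
  restriction to any `S' → M ⊗ ℂ`;
* `isQuasiProjectiveOver_baseChange_M`, `smooth_baseChange_M`, `isQuasiProjectiveOver_of_isOpenImmersion_M`,
  `isQuasiProjectiveOver_familyPullback_univFamilyℂ` — quasi-projectivity / smoothness of `M ⊗ ℂ`, of its open
  pieces and of the restricted total spaces, from (F-c′)/(F-c″);
* HEAD `exists_hodgeFrames_familyPullback_univFamilyℂ` — for every open piece `ι : S' → M ⊗ ℂ` that is smooth
  of some pure dimension `d`, the conclusion of Griffiths' theorem (subbundle-frame form, the tree's statement
  VERBATIM) for the restricted universal family `familyPullback.snd (univFamilyℂ 𝓜) ι`: near every point `t₁` of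
  `S'(ℂ)` the steps `F^pH^k(X_t)`, read on `ℂ ⊗ H^k(X_s; ℚ)` along flat continuation, are framed by linearly
  independent vectors with holomorphic coordinates;
* `exists_smooth_pieces_baseChange_M` — `M ⊗ ℂ` is covered by finitely many such pieces (its components cofan,
  `HodgeTheory.exists_components_isColimit_of_smooth`), so the head applies around EVERY point of `M ⊗ ℂ`;
* `exists_isHodgeSymmetric_hodgeModel_fiberOver`, `isCohomologicallyLocallyTrivialOn_familyPullback_univFamilyℂ`
  — the remaining binders of the head (Hodge models of the fibres, cohomological local triviality) are inhabited.

## References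

* [Griffiths1968PeriodsII] P. Griffiths, Periods of integrals on algebraic manifolds II, Amer. J. Math. 90 (1968),
  Thm. 1.1.
* [VoisinHodgeI2002] C. Voisin, Hodge Theory and Complex Algebraic Geometry I, CUP (2002), §10.2.1 Thm. 10.3.
* [MumfordFogartyKirwan1994] D. Mumford, J. Fogarty, F. Kirwan, Geometric Invariant Theory (3rd ed.), Ch. 7 §3
  Thm. 7.9 (p. 139) and Appendix 7A (p. 235).
* [Lan2013PELCompactifications] K.-W. Lan, Arithmetic compactifications of PEL-type Shimura varieties, Thm. 1.4.1.11,
  Cor. 7.2.3.9.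
-/

set_option autoImplicit false

-- mandated namespace `Summit.HodgeConjecture.HodgeConjecture.Theorems` trips `linter.dupNamespace` (single-problem summit; the lakefile turns
-- the linter off tree-wide as a weak option), restated here so stand-alone elaboration is warning-free (as in ★ `MumfordMarkingTransport`).
set_option linter.dupNamespace false

noncomputable section

open CategoryTheory CategoryTheory.Limits AlgebraicGeometry
open _root_.Topology _root_.Filter
open scoped TensorProduct

namespace Summit.HodgeConjecture.HodgeConjecture.Theorems

namespace UnivFamilyHodgeFrames

open Literature.AlgebraicGeometry
open Literature.AlgebraicGeometry.Motives
open Literature.AlgebraicGeometry.HodgeTheory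
open Literature.AlgebraicGeometry.AbelianSchemes (PolarizedAbelianSchemeWithLevel)
open Literature.AlgebraicGeometry.ModuliOfAbelianVarieties
open Literature.AlgebraicGeometry.ModuliOfAbelianVarieties.W1
open Literature.AlgebraicTopology.SingularHomology

variable {g N : ℕ} {δ : Fin g → ℕ} (𝓜 : SiegelFineModuliScheme g N δ)

/-! ### The complexified universal family is a smooth projective family — without (U) -/

/-- **Every complex fibre of the complexified universal family is a smooth projective variety of dimension `g`**,
(U)-free: the `ℚ`-side reading `s` of the complex point `t` is a `ℚ`-morphism `Spec ℂ → M`; the universal triple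
pulls back along it (D-BC∃, `PolarizedAbelianSchemeWithLevel.exists_isBaseChangeVia`), the fibre of `X ⊗ ℂ → M ⊗ ℂ`
over `t` is the abelian scheme of that pull-back (`W1.fiberUnivIsoOfIsBaseChangeVia`), and the abelian scheme of a
triple over `Spec ℂ` is smooth projective of dimension `g` (`W1.isSmoothProjective_tripleA`).
[cite: MumfordFogartyKirwan1994, Ch. 7 §2 Definition 7.2 (p. 129) and §3 Theorem 7.9 (p. 139)] -/
theorem isSmoothProjective_fiberOver_univFamilyℂ (t : ComplexPoints ((Motives.baseChange ℚ ℂ).obj 𝓜.M)) :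
    IsSmoothProjective g (fiberOver (univFamilyℂ 𝓜) t) := by
  obtain ⟨P', G, Ĝ, h⟩ := PolarizedAbelianSchemeWithLevel.exists_isBaseChangeVia 𝓜.univ
    ((AlgPoints.baseChangeEquiv (algebraMap ℚ ℂ) 𝓜.M).symm t).left
  exact (isSmoothProjective_tripleA P').of_iso (fiberUnivIsoOfIsBaseChangeVia 𝓜 t P' G Ĝ h).symm

/-- **The complexified universal family `X ⊗ ℂ → M ⊗ ℂ` is a smooth projective family of relative dimension `g`** —
(U)-FREE edition of `W1.isSmoothProjectiveFamily_univFamilyℂ`: smooth of relative dimension `g` and proper by base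
change of the universal abelian scheme's structure morphism (`Motives.isPullback_baseChangeHom_map_left`), fibres by
`isSmoothProjective_fiberOver_univFamilyℂ`. [cite: MumfordFogartyKirwan1994, Ch. 7 §3 Theorem 7.9 (p. 139)] -/
theorem isSmoothProjectiveFamily_univFamilyℂ_of_classify : IsSmoothProjectiveFamily (univFamilyℂ 𝓜) g := by
  have sq := Motives.isPullback_baseChangeHom_map_left (algebraMap ℚ ℂ) (univFamily 𝓜)
  refine ⟨?_, ?_, fun t => isSmoothProjective_fiberOver_univFamilyℂ 𝓜 t⟩
  · have h0 : SmoothOfRelativeDimension g (univFamily 𝓜).left := (𝓜.univ.A.isOfRelDim_iff g).1 𝓜.univ.relDim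
    haveI := smoothOfRelativeDimension_isStableUnderBaseChange (n := g)
    exact MorphismProperty.IsStableUnderBaseChange.of_isPullback sq h0
  · have h0 : IsProper (univFamily 𝓜).left := 𝓜.univ.A.isProper
    exact MorphismProperty.IsStableUnderBaseChange.of_isPullback sq h0

/-- **The universal family restricted to any `ι : S' → M ⊗ ℂ` is a smooth projective family of relative dimension
`g`** (base change, `IsSmoothProjectiveFamily.familyPullback_snd`). [cite: MumfordFogartyKirwan1994, Appendix to Ch. 7 §A (p. 235)] -/
theorem isSmoothProjectiveFamily_familyPullback_univFamilyℂ {S' : SchemeOver ℂ}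
    (ι : S' ⟶ (Motives.baseChange ℚ ℂ).obj 𝓜.M) :
    IsSmoothProjectiveFamily (familyPullback.snd (univFamilyℂ 𝓜) ι) g :=
  (isSmoothProjectiveFamily_univFamilyℂ_of_classify 𝓜).familyPullback_snd ι

/-! ### Quasi-projectivity and smoothness from (F-c′)/(F-c″) -/

/-- **`M ⊗ ℂ` is quasi-projective over `ℂ`** when `M` is quasi-projective over `ℚ` ((F-c′) + base change,
`IsQuasiProjectiveOver.baseChangeHom`). [cite: Lan2013PELCompactifications, Cor. 7.2.3.9 (p. 518)] -/
theorem isQuasiProjectiveOver_baseChange_M (hMq : IsQuasiProjectiveOver 𝓜.M) :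
    IsQuasiProjectiveOver ((Motives.baseChange ℚ ℂ).obj 𝓜.M) :=
  IsQuasiProjectiveOver.baseChangeHom (algebraMap ℚ ℂ) hMq

/-- **`M ⊗ ℂ` is smooth over `ℂ`** when `M` is smooth over `ℚ` ((F-c′) + base change). [cite: Lan2013PELCompactifications, Thm. 1.4.1.11 (p. 91)] -/
theorem smooth_baseChange_M (hMs : Smooth 𝓜.M.hom) : Smooth ((Motives.baseChange ℚ ℂ).obj 𝓜.M).hom := by
  change Smooth (pullback.snd 𝓜.M.hom (Spec.map (CommRingCat.ofHom (algebraMap ℚ ℂ))))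
  exact MorphismProperty.pullback_snd (P := @Smooth) _ _ hMs

/-- **An open piece `ι : S' → M ⊗ ℂ` is quasi-projective over `ℂ`** ((F-c′) + base change + open immersion).
[cite: Lan2013PELCompactifications, Cor. 7.2.3.9 (p. 518)] -/
theorem isQuasiProjectiveOver_of_isOpenImmersion_M (hMq : IsQuasiProjectiveOver 𝓜.M) {S' : SchemeOver ℂ}
    (ι : S' ⟶ (Motives.baseChange ℚ ℂ).obj 𝓜.M) [IsOpenImmersion ι.left] : IsQuasiProjectiveOver S' :=
  IsQuasiProjectiveOver.of_isOpenImmersion ι (isQuasiProjectiveOver_baseChange_M 𝓜 hMq)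

/-- **An open piece of the smooth `M ⊗ ℂ` is smooth over `ℂ`.** [cite: Lan2013PELCompactifications, Thm. 1.4.1.11 (p. 91)] -/
theorem smooth_of_isOpenImmersion_M (hMs : Smooth 𝓜.M.hom) {S' : SchemeOver ℂ}
    (ι : S' ⟶ (Motives.baseChange ℚ ℂ).obj 𝓜.M) [IsOpenImmersion ι.left] : Smooth S'.hom := by
  haveI := smooth_baseChange_M 𝓜 hMs
  rw [← Over.w ι]
  infer_instance

/-- **The total space of the universal family restricted to an open piece is quasi-projective over `ℂ`**: it is open
in `X ⊗ ℂ` (base change of the open immersion `ι`), and `X ⊗ ℂ` is quasi-projective by (F-c″) and base change.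
[cite: MumfordFogartyKirwan1994, Ch. 7 §3 Theorem 7.9 and Prop. 7.3 (pp. 131–139)] -/
theorem isQuasiProjectiveOver_familyPullback_univFamilyℂ (hXq : IsQuasiProjectiveOver (univTotal 𝓜)) {S' : SchemeOver ℂ}
    (ι : S' ⟶ (Motives.baseChange ℚ ℂ).obj 𝓜.M) [IsOpenImmersion ι.left] :
    IsQuasiProjectiveOver (familyPullback (univFamilyℂ 𝓜) ι) := by
  haveI : IsOpenImmersion (familyPullback.fst (univFamilyℂ 𝓜) ι).left := by
    change IsOpenImmersion (pullback.fst (univFamilyℂ 𝓜).left ι.left)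
    infer_instance
  exact IsQuasiProjectiveOver.of_isOpenImmersion (familyPullback.fst (univFamilyℂ 𝓜) ι)
    (IsQuasiProjectiveOver.baseChangeHom (algebraMap ℚ ℂ) hXq)

/-! ### The head: Griffiths frames for the universal family on a smooth pure-dimensional open piece -/

/-- **Griffiths' theorem for the universal family over the Siegel fine moduli scheme (Voisin I Thm. 10.3 / Griffiths
1968 Thm. 1.1, via the tree's theorem `griffiths1968_holomorphicHodgeSubbundlesQP_holds`).** Let `𝓜` be a Siegel fine
moduli scheme with `M` quasi-projective over `ℚ` and quasi-projective universal total space ((F-c′)/(F-c″) — for every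
`𝓜` by `M1primeOfFU.smooth_qproj_of_F`), `ι : S' → M ⊗ ℂ` an open piece smooth of pure dimension `d`, and
`f := familyPullback.snd (univFamilyℂ 𝓜) ι` the restricted universal family. Then for every degree `k`, every
cohomological local trivialisation datum `hU`, every choice of Hodge-symmetric Hodge models `A t` of the fibres, every
base point `s`, every point `t₁` of `S'(ℂ)` and every neighbourhood `N` of `t₁`: there is a path-connected open
`W ∋ t₁`, `W ⊆ N`, inside a chart `ψ : S'(ℂ) → ℂ^d`, such that for every admissible reference state `T₁` at `t₁` and
every `p`, the `p`-th Hodge filtration step of the transported Hodge structures along the continuations of `T₁` inside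
`W` is the span of a linearly independent family of vectors of `Hᵏ(X_s; ℚ) ⊗ ℂ` whose coordinates are holomorphic on
`ψ(W)` — the conclusion of the tree's statement `Griffiths1968_holomorphicHodgeSubbundlesQP` VERBATIM for this family.
No uniformisation input is used. [cite: VoisinHodgeI2002, §10.2.1 Thm. 10.3 and §9.2.1] [cite: Griffiths1968PeriodsII, Thm. 1.1]
[cite: MumfordFogartyKirwan1994, Ch. 7 §3 Theorem 7.9 (p. 139) and Appendix to Ch. 7 §A (p. 235)] -/
theorem exists_hodgeFrames_familyPullback_univFamilyℂ (hMq : IsQuasiProjectiveOver 𝓜.M)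
    (hXq : IsQuasiProjectiveOver (univTotal 𝓜)) {S' : SchemeOver ℂ} (ι : S' ⟶ (Motives.baseChange ℚ ℂ).obj 𝓜.M)
    [IsOpenImmersion ι.left] (d : ℕ) [AlgebraicGeometry.SmoothOfRelativeDimension d S'.hom] (k : ℕ)
    (hU : IsCohomologicallyLocallyTrivialOn (familyPullback.snd (univFamilyℂ 𝓜) ι)
      (Set.univ : Set (ComplexPoints S')))
    (A : ∀ t : ComplexPoints S', HodgeModel g (fiberOver (familyPullback.snd (univFamilyℂ 𝓜) ι) t))
    (hA : ∀ t, (A t).IsHodgeSymmetric)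
    (s t₁ : (Set.univ : Set (ComplexPoints S'))) (N : Set (Set.univ : Set (ComplexPoints S'))) (hN : N ∈ 𝓝 t₁) :
    ∃ W : Set (Set.univ : Set (ComplexPoints S')), IsOpen W ∧ t₁ ∈ W ∧ W ⊆ N ∧ IsPathConnected W ∧
    ∃ ψ : OpenPartialHomeomorph (Set.univ : Set (ComplexPoints S')) (Fin d → ℂ),
      W ⊆ ψ.source ∧
    ∀ (T₁ : singularCohomology ℚ ℚ (ComplexPoints (fiberOver (familyPullback.snd (univFamilyℂ 𝓜) ι) s.1)) k ≃ₗ[ℚ]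
        singularCohomology ℚ ℚ (ComplexPoints (fiberOver (familyPullback.snd (univFamilyℂ 𝓜) ι) t₁.1)) k),
      (∃ δ₁ : Path.Homotopic.Quotient s t₁,
        ∀ v, ofRatClass _ k (T₁ v) =
          transportFun (familyPullback.snd (univFamilyℂ 𝓜) ι) k hU δ₁ (ofRatClass _ k v)) →
      ∀ p : ℤ, ∃ (r : ℕ)
        (w : Fin r → Set.Elem (Set.univ : Set (ComplexPoints S')) →
          ℂ ⊗[ℚ] singularCohomology ℚ ℚ
            (ComplexPoints (fiberOver (familyPullback.snd (univFamilyℂ 𝓜) ι) s.1)) k),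
        (∀ t ∈ W, ∀ (ε : Path t₁ t), (∀ r', ε r' ∈ W) →
          ∀ (T : singularCohomology ℚ ℚ
              (ComplexPoints (fiberOver (familyPullback.snd (univFamilyℂ 𝓜) ι) s.1)) k ≃ₗ[ℚ]
            singularCohomology ℚ ℚ
              (ComplexPoints (fiberOver (familyPullback.snd (univFamilyℂ 𝓜) ι) t.1)) k),
          (∀ v, ofRatClass _ k (T v) =
            transportFun (familyPullback.snd (univFamilyℂ 𝓜) ι) k hU ⟦ε⟧ (ofRatClass _ k (T₁ v))) →
          LinearIndependent ℂ (fun i ↦ w i t) ∧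
            (((A t.1).hodgeStructure
                ((isSmoothProjectiveFamily_familyPullback_univFamilyℂ 𝓜 ι).isSmoothProjective t.1)
                (hA t.1) k).comapEquiv T).F p =
              Submodule.span ℂ (Set.range fun i ↦ w i t)) ∧
        (∀ (i : Fin r)
          (φ : Module.Dual ℂ (ℂ ⊗[ℚ] singularCohomology ℚ ℚ
            (ComplexPoints (fiberOver (familyPullback.snd (univFamilyℂ 𝓜) ι) s.1)) k)),
          AnalyticOnNhd ℂ (fun z ↦ φ (w i (ψ.symm z))) (ψ '' W)) := by
  have hf := isSmoothProjectiveFamily_familyPullback_univFamilyℂ 𝓜 ι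
  have hS' : IsQuasiProjectiveOver S' := isQuasiProjectiveOver_of_isOpenImmersion_M 𝓜 hMq ι
  have hX' : IsQuasiProjectiveOver (familyPullback (univFamilyℂ 𝓜) ι) :=
    isQuasiProjectiveOver_familyPullback_univFamilyℂ 𝓜 hXq ι
  haveI : ∀ t : ComplexPoints S',
      Module.Finite ℚ (singularCohomology ℚ ℚ
        (ComplexPoints (fiberOver (familyPullback.snd (univFamilyℂ 𝓜) ι) t)) k) :=
    fun t ↦ finite_singularCohomology_rat_complexPoints (hf.isSmoothProjective t) k
  exact griffiths1968_holomorphicHodgeSubbundlesQP_holds (familyPullback.snd (univFamilyℂ 𝓜) ι) g k d hf hS' hX'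
    hU A hA s t₁ N hN

/-! ### The binders of the head are inhabited, and the pieces exist -/

/-- **Cohomological local triviality of the restricted universal family over a smooth pure-dimensional open piece**
(the tree's `isCohomologicallyLocallyTrivialOn_univ_of_isSmoothProjectiveFamily`; discharges the binder `hU` of the head).
[cite: VoisinHodgeI2002, §9.2.1] -/
theorem isCohomologicallyLocallyTrivialOn_familyPullback_univFamilyℂ (hMq : IsQuasiProjectiveOver 𝓜.M)
    {S' : SchemeOver ℂ} (ι : S' ⟶ (Motives.baseChange ℚ ℂ).obj 𝓜.M) [IsOpenImmersion ι.left] (d : ℕ)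
    [AlgebraicGeometry.SmoothOfRelativeDimension d S'.hom] :
    IsCohomologicallyLocallyTrivialOn (familyPullback.snd (univFamilyℂ 𝓜) ι) (Set.univ : Set (ComplexPoints S')) :=
  isCohomologicallyLocallyTrivialOn_univ_of_isSmoothProjectiveFamily _ d
    (isSmoothProjectiveFamily_familyPullback_univFamilyℂ 𝓜 ι) (isQuasiProjectiveOver_of_isOpenImmersion_M 𝓜 hMq ι)

/-- **Hodge-symmetric Hodge models of the fibres of the restricted universal family exist** (every smooth projective
complex variety has a real Hodge model, `exists_isReal_hodgeModel_holds`, and real models are Hodge symmetric,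
`HodgeModel.IsReal.isHodgeSymmetric`; discharges the binders `A`/`hA` of the head up to a choice).
[cite: VoisinHodgeI2002, §6.1.3 Prop. 6.11 and Cor. 6.12] -/
theorem exists_isHodgeSymmetric_hodgeModel_fiberOver {S' : SchemeOver ℂ} (ι : S' ⟶ (Motives.baseChange ℚ ℂ).obj 𝓜.M) :
    ∃ A : ∀ t : ComplexPoints S', HodgeModel g (fiberOver (familyPullback.snd (univFamilyℂ 𝓜) ι) t),
      ∀ t, (A t).IsHodgeSymmetric := by
  have hf := isSmoothProjectiveFamily_familyPullback_univFamilyℂ 𝓜 ι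
  have h : ∀ t : ComplexPoints S',
      ∃ A : HodgeModel g (fiberOver (familyPullback.snd (univFamilyℂ 𝓜) ι) t), A.IsHodgeSymmetric := fun t ↦ by
    obtain ⟨A, hA⟩ := exists_isReal_hodgeModel_holds g _ (hf.isSmoothProjective t)
    exact ⟨A, hA.isHodgeSymmetric⟩
  choose A hA using h
  exact ⟨A, hA⟩

/-- **`M ⊗ ℂ` is covered by finitely many smooth pure-dimensional quasi-projective open pieces** — its components
cofan (`HodgeTheory.exists_components_isColimit_of_smooth` for the smooth quasi-projective `M ⊗ ℂ`): open (and closed)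
immersions `e c : E c → M ⊗ ℂ`, each `E c` smooth of some pure dimension `d c`, whose images on complex points form a
clopen partition of `(M ⊗ ℂ)(ℂ)`, with `M ⊗ ℂ ≅ ∐ E c`. The head `exists_hodgeFrames_familyPullback_univFamilyℂ`
applies on every piece, hence around EVERY complex point of `M ⊗ ℂ`.
[cite: GortzWedhorn2020, Exercise 3.16 (p. 117) and Thm. 6.28] [cite: Lan2013PELCompactifications, Thm. 1.4.1.11 and Cor. 7.2.3.9] -/
theorem exists_smooth_pieces_baseChange_M (hMs : Smooth 𝓜.M.hom) (hMq : IsQuasiProjectiveOver 𝓜.M) :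
    ∃ (C : Type) (_ : Finite C) (E : C → SchemeOver ℂ) (e : ∀ c, E c ⟶ (Motives.baseChange ℚ ℂ).obj 𝓜.M)
      (d : C → ℕ),
      (∀ c, IsOpenImmersion (e c).left) ∧ (∀ c, IsClosedImmersion (e c).left) ∧
        (∀ c, IsQuasiProjectiveOver (E c)) ∧ (∀ c, SmoothOfRelativeDimension (d c) (E c).hom) ∧
        IsClopenPartition (fun c => Set.range (AlgPoints.map (L := ℂ) (e c))) ∧
        Nonempty (IsColimit (Cofan.mk ((Motives.baseChange ℚ ℂ).obj 𝓜.M) e)) := by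
  haveI := smooth_baseChange_M 𝓜 hMs
  obtain ⟨C, hC, E, e, hopen, hclosed, -, hqp, hdim, -, hpart, -, hcol⟩ :=
    exists_components_isColimit_of_smooth ((Motives.baseChange ℚ ℂ).obj 𝓜.M) (isQuasiProjectiveOver_baseChange_M 𝓜 hMq)
  choose d hd using hdim
  exact ⟨C, hC, E, e, d, hopen, hclosed, hqp, hd, hpart, hcol⟩

end UnivFamilyHodgeFrames

end Summit.HodgeConjecture.HodgeConjecture.Theorems

end
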